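import Literature.NumberTheory.EllipticCurves.BhargavaHo2022.TwoMarkedPoints
import Literature.NumberTheory.EllipticCurves.BSDWave0Proofs
import Literature.NumberTheory.EllipticCurves.CongruentNumberCurve29274Rank
import HarnessLib

/-!
# BirchSwinnertonDyer / CountingDoorF2AtThree — negative lemma for crux I1 `SelmerThreeAverageLargeF2`
# (stmt-BirchSwinnertonDyer-19440): the hypothesis `IsLarge` is LOAD-BEARING

Route `route-BirchSwinnertonDyer-CountingDoorF2AtThree` (cell bsd-rank2, TWIN leaf
`PAdicBSDRankTwoPositiveProportion`). Crux I1 reads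
`∀ Φ : CongruenceFamily₂, Φ.IsLarge → Φ.AverageOnLE (fun a ↦ #Sel₃(E_a)) 36`. This file proves, with no
hypothesis and no named fact, that the same sentence WITHOUT `Φ.IsLarge` is false — also in the variant
that keeps the side condition «nonempty residue set at every prime» carried by the route's other items —
and records the witness:

* §1 POINT FAMILIES. A subfamily `Φ` of Bhargava–Ho's `F₂` whose condition at every prime `p` is
  «`a ≡ a₀ (mod p)`» (one residue class modulo `p`, exponent `1`, at EVERY prime) has exactly one member,
  `a₀` (an integer divisible by every prime is `0`): `mem_iff_eq_of_pointFamily`; it has a nonempty residue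
  set at every prime (`residues_nonempty_of_pointFamily`), it is NOT large (`not_isLarge_of_pointFamily`:
  largeness at `p` would force every member of `F₂` with `p² ∤ Δ` into the class of `a₀`), and its height
  averages are eventually the value at `a₀`, so `Φ.AverageOnLE f c ↔ f a₀ ≤ c`
  (`averageOnLE_iff_of_pointFamily`). The explicit family `⟨fun _ ↦ 1, fun p ↦ {a₀ mod p}⟩` is such a
  point family (`pointFamily_residues_iff`).
* §2 THE WITNESS MEMBER. The parameter `a₀ = (a₁, a₂, a₂', a₃) = (0, -29274, 0, 0)` of `F₂` is Wiman's
  congruent number curve `y² = x³ - 29274²x` (`curve_wiman : a₀.curve = congruentNumberCurve 29274`; the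
  marked points `(-29274, 0)`, `(0, 0)` are `2`-torsion here, which membership in `F₂` — `Δ ≠ 0` — allows),
  of Mordell–Weil rank `≥ 4` by the tree's kernel `2`-descent
  (`Literature.NumberTheory.EllipticCurves.CongruentNumber29274.four_le_mordellWeilRank`), hence
  `#Sel₃(E_{a₀}) ≥ 3⁴ = 81` by the Kummer injection (tree theorem
  `WeierstrassCurve.pow_rank_le_card_selmerGroup`, Silverman X.4.2; cf. p582870).
* §3 THE NEGATIVE LEMMAS. `not_selmerThreeAverage_without_isLarge`:
  `¬ ∀ Φ, Φ.AverageOnLE (fun a ↦ #Sel₃(E_a)) 36`; the same with nonempty residues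
  (`not_selmerThreeAverage_of_residues_nonempty_without_isLarge`), for every constant `c < 81`
  (`not_selmerThreeAverage_without_isLarge_of_lt`), and for the rank moment `3^{rank}`
  (`not_rankMomentThree_without_isLarge`). So any proof of I1 must use `IsLarge` (or at least exclude the
  point families), and the route's «nonempty residues» side condition is not what excludes them.

The file is ROUTE-FREE (it imports no `Theses` module; the sentences negated in §3 are the route decl
`SelmerThreeAverageLargeF2` with its hypothesis `Φ.IsLarge` deleted, written out over the Literature
vocabulary `BhargavaHo2022.CongruenceFamily₂`) and uses no named fact.

HONEST FRAMING (B1). A hygiene / tightness statement about an OPEN crux: I1 itself is neither proved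
nor refuted (the witness family is not large); nothing reads an analytic rank; no S0 motion; BSD is not
proved by any of this. PARTITION: none — r_an ≥ 2, summit axis S0; TWIN (D-0056): n/a.

References: M. Bhargava, W. Ho, arXiv:2207.03309 (2022), §1 (large subfamilies) [BhargavaHo2022];
A. Wiman, Acta Math. 77 (1945) (the rank-4 congruent number curve `n = 29274`) via the tree file
`Literature/NumberTheory/EllipticCurves/CongruentNumberCurve29274Rank.lean`; J. Silverman, AEC X.4.2
(Kummer sequence) [SilvermanAEC2009].
-/

set_option linter.dupNamespace false

noncomputable section

open scoped Classical
open Filter Topology Finset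
open WeierstrassCurve Literature.NumberTheory.EllipticCurves
  Literature.NumberTheory.EllipticCurves.BhargavaHo2022

namespace Summit.BirchSwinnertonDyer.BirchSwinnertonDyer.Theorems

/-! ### §1 Point families: one residue class modulo every prime -/

/-- An integer divisible by every prime `p ≥ N` is `0`. [folklore] -/
theorem int_eq_zero_of_forall_prime_ge_dvd {d : ℤ} (N : ℕ)
    (h : ∀ p : ℕ, N ≤ p → p.Prime → (p : ℤ) ∣ d) : d = 0 := by
  obtain ⟨p, hp, hprime⟩ := Nat.exists_infinite_primes (max N (d.natAbs + 1))
  refine Int.eq_zero_of_dvd_of_natAbs_lt_natAbs (h p (le_of_max_le_left hp) hprime) ?_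
  rw [Int.natAbs_natCast]
  exact Nat.lt_of_lt_of_le (Nat.lt_succ_self _) (le_of_max_le_right hp)

variable (Φ : CongruenceFamily₂) (a₀ : Params)

/-- **A point family has exactly one member.** Call `Φ` a POINT FAMILY at `a₀` when at every prime `p`
its residue condition is «`a ≡ a₀ (mod p)`» coordinate-wise (the hypothesis `hΦ`; the explicit family
`⟨fun _ ↦ 1, fun p ↦ {a₀ mod p}⟩` is one, `pointFamily_residues_iff`; kept as a hypothesis of the lemmas
below, not as a definition). Then `Φ.Mem a ↔ (Δ(a) ≠ 0 ∧ a = a₀)`: each coordinate of `a - a₀` is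
divisible by every prime, hence `0`. [cite: BhargavaHo2022, §1 (subfamilies defined by congruence conditions)] -/
theorem mem_iff_eq_of_pointFamily
    (hΦ : ∀ p : ℕ, p.Prime → ∀ a : Params, (Φ.residueOf p a ∈ Φ.residues p ↔
      ((p : ℤ) ∣ a.a₁ - a₀.a₁ ∧ (p : ℤ) ∣ a.a₂ - a₀.a₂ ∧ (p : ℤ) ∣ a.a₂' - a₀.a₂' ∧
        (p : ℤ) ∣ a.a₃ - a₀.a₃)))
    (a : Params) : Φ.Mem a ↔ a.IsMember ∧ a = a₀ := by
  constructor
  · rintro ⟨ha, hres⟩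
    refine ⟨ha, ?_⟩
    have h := fun p (hp : (p : ℕ).Prime) ↦ (hΦ p hp a).mp (hres p hp)
    have h₁ : a.a₁ - a₀.a₁ = 0 :=
      int_eq_zero_of_forall_prime_ge_dvd 0 fun p _ hp ↦ (h p hp).1
    have h₂ : a.a₂ - a₀.a₂ = 0 :=
      int_eq_zero_of_forall_prime_ge_dvd 0 fun p _ hp ↦ (h p hp).2.1
    have h₃ : a.a₂' - a₀.a₂' = 0 :=
      int_eq_zero_of_forall_prime_ge_dvd 0 fun p _ hp ↦ (h p hp).2.2.1
    have h₄ : a.a₃ - a₀.a₃ = 0 :=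
      int_eq_zero_of_forall_prime_ge_dvd 0 fun p _ hp ↦ (h p hp).2.2.2
    cases a; cases a₀
    simp only [Params.mk.injEq]
    simp only at h₁ h₂ h₃ h₄
    omega
  · rintro ⟨ha, rfl⟩
    exact ⟨ha, fun p hp ↦ (hΦ p hp a).mpr ⟨by simp, by simp, by simp, by simp⟩⟩

/-- A point family has a nonempty residue set at every prime (the class of `a₀` itself).
[cite: BhargavaHo2022, §1 (subfamilies defined by congruence conditions)] -/
theorem residues_nonempty_of_pointFamily
    (hΦ : ∀ p : ℕ, p.Prime → ∀ a : Params, (Φ.residueOf p a ∈ Φ.residues p ↔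
      ((p : ℤ) ∣ a.a₁ - a₀.a₁ ∧ (p : ℤ) ∣ a.a₂ - a₀.a₂ ∧ (p : ℤ) ∣ a.a₂' - a₀.a₂' ∧
        (p : ℤ) ∣ a.a₃ - a₀.a₃)))
    (p : ℕ) (hp : p.Prime) : (Φ.residues p).Nonempty :=
  ⟨Φ.residueOf p a₀, (hΦ p hp a₀).mpr ⟨by simp, by simp, by simp, by simp⟩⟩

/-- **A point family is not large.** If `Φ` were large at every prime `p ≥ p₀`, then a second member
`b ≠ a₀` of `F₂` (one of `(0,0,1,0)`, `(0,0,2,0)`: the curves `y² = x³ - x`, `y² = x³ - 4x`) would satisfy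
`b ≡ a₀ (mod p)` for every prime `p ≥ p₀` not dividing `Δ(b)` to the square, i.e. for all large `p`,
forcing `b = a₀`. [cite: BhargavaHo2022, §1 (definition of "large at p")] -/
theorem not_isLarge_of_pointFamily
    (hΦ : ∀ p : ℕ, p.Prime → ∀ a : Params, (Φ.residueOf p a ∈ Φ.residues p ↔
      ((p : ℤ) ∣ a.a₁ - a₀.a₁ ∧ (p : ℤ) ∣ a.a₂ - a₀.a₂ ∧ (p : ℤ) ∣ a.a₂' - a₀.a₂' ∧
        (p : ℤ) ∣ a.a₃ - a₀.a₃))) :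
    ¬ Φ.IsLarge := by
  rintro ⟨p₀, hlarge⟩
  -- two distinct members of `F₂`; at least one differs from `a₀`
  have hm₁ : (⟨0, 0, 1, 0⟩ : Params).IsMember := by
    simp only [Params.IsMember, Params.curveInt]
    norm_num [WeierstrassCurve.Δ, WeierstrassCurve.b₂, WeierstrassCurve.b₄, WeierstrassCurve.b₆,
      WeierstrassCurve.b₈]
  have hm₂ : (⟨0, 0, 2, 0⟩ : Params).IsMember := by
    simp only [Params.IsMember, Params.curveInt]
    norm_num [WeierstrassCurve.Δ, WeierstrassCurve.b₂, WeierstrassCurve.b₄, WeierstrassCurve.b₆,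
      WeierstrassCurve.b₈]
  -- generic step: a member `b` of `F₂` lies in the class of `a₀` modulo every large prime, hence `b = a₀`
  have key : ∀ b : Params, b.IsMember → b = a₀ := by
    intro b hb
    -- primes `p ≥ max p₀ (|Δ(b)| + 1)` do not divide `Δ(b)`, let alone to the square
    have hcong : ∀ p : ℕ, max p₀ (b.curveInt.Δ.natAbs + 1) ≤ p → p.Prime →
        ((p : ℤ) ∣ b.a₁ - a₀.a₁ ∧ (p : ℤ) ∣ b.a₂ - a₀.a₂ ∧ (p : ℤ) ∣ b.a₂' - a₀.a₂' ∧
          (p : ℤ) ∣ b.a₃ - a₀.a₃) := by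
      intro p hp hprime
      refine (hΦ p hprime b).mp (hlarge p (le_of_max_le_left hp) hprime b hb ?_)
      intro hsq
      have hdvd : (p : ℤ) ∣ b.curveInt.Δ := (dvd_pow_self (p : ℤ) two_ne_zero).trans hsq
      have h0 := Int.eq_zero_of_dvd_of_natAbs_lt_natAbs hdvd (by
        rw [Int.natAbs_natCast]
        exact Nat.lt_of_lt_of_le (Nat.lt_succ_self _) (le_of_max_le_right hp))
      exact hb h0
    have h₁ : b.a₁ - a₀.a₁ = 0 :=
      int_eq_zero_of_forall_prime_ge_dvd _ fun p hp hpr ↦ (hcong p hp hpr).1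
    have h₂ : b.a₂ - a₀.a₂ = 0 :=
      int_eq_zero_of_forall_prime_ge_dvd _ fun p hp hpr ↦ (hcong p hp hpr).2.1
    have h₃ : b.a₂' - a₀.a₂' = 0 :=
      int_eq_zero_of_forall_prime_ge_dvd _ fun p hp hpr ↦ (hcong p hp hpr).2.2.1
    have h₄ : b.a₃ - a₀.a₃ = 0 :=
      int_eq_zero_of_forall_prime_ge_dvd _ fun p hp hpr ↦ (hcong p hp hpr).2.2.2
    cases b; cases a₀
    simp only [Params.mk.injEq]
    simp only at h₁ h₂ h₃ h₄
    omega
  have e₁ := key _ hm₁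
  have e₂ := key _ hm₂
  rw [← e₂] at e₁
  simp only [Params.mk.injEq] at e₁
  omega

variable {Φ a₀}

/-- The members of a point family of height `< X` are exactly `{a₀}` once `X` exceeds the height of `a₀`.
[cite: BhargavaHo2022, §1 (ordering by height)] -/
theorem below_eq_singleton_of_pointFamily
    (hΦ : ∀ p : ℕ, p.Prime → ∀ a : Params, (Φ.residueOf p a ∈ Φ.residues p ↔
      ((p : ℤ) ∣ a.a₁ - a₀.a₁ ∧ (p : ℤ) ∣ a.a₂ - a₀.a₂ ∧ (p : ℤ) ∣ a.a₂' - a₀.a₂' ∧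
        (p : ℤ) ∣ a.a₃ - a₀.a₃)))
    (ha₀ : a₀.IsMember) {X : ℕ} (hX : a₀.height < X) : Φ.below X = {a₀} := by
  refine Finset.eq_singleton_iff_unique_mem.mpr ⟨?_, fun a ha ↦ ?_⟩
  · rw [CongruenceFamily₂.mem_below_iff]
    exact ⟨(mem_iff_eq_of_pointFamily Φ a₀ hΦ a₀).mpr ⟨ha₀, rfl⟩, hX⟩
  · rw [CongruenceFamily₂.mem_below_iff] at ha
    exact ((mem_iff_eq_of_pointFamily Φ a₀ hΦ a).mp ha.1).2

/-- On a point family the height average of any `f` is eventually the value `f a₀`.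
[cite: BhargavaHo2022, Thm. 1.1 (shape: averages ordered by height)] -/
theorem averageOn_eq_of_pointFamily
    (hΦ : ∀ p : ℕ, p.Prime → ∀ a : Params, (Φ.residueOf p a ∈ Φ.residues p ↔
      ((p : ℤ) ∣ a.a₁ - a₀.a₁ ∧ (p : ℤ) ∣ a.a₂ - a₀.a₂ ∧ (p : ℤ) ∣ a.a₂' - a₀.a₂' ∧
        (p : ℤ) ∣ a.a₃ - a₀.a₃)))
    (ha₀ : a₀.IsMember) (f : Params → ℝ) {X : ℕ} (hX : a₀.height < X) :
    Φ.averageOn f X = f a₀ := by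
  rw [CongruenceFamily₂.averageOn, below_eq_singleton_of_pointFamily hΦ ha₀ hX, Finset.sum_singleton,
    Finset.card_singleton, Nat.cast_one, div_one]

/-- The height bound eventually exceeds the height of `a₀`. [folklore] -/
theorem eventually_height_lt (a₀ : Params) : ∀ᶠ X : ℕ in atTop, a₀.height < X := by
  refine (eventually_ge_atTop (a₀.height.toNat + 1)).mono fun X hX ↦ ?_
  have h0 : (a₀.height.toNat : ℤ) = a₀.height := Int.toNat_of_nonneg (Params.height_nonneg a₀)
  have hX' : (a₀.height.toNat : ℤ) + 1 ≤ (X : ℤ) := by exact_mod_cast hX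
  omega

/-- **On a point family, `AverageOnLE f c` is the inequality `f a₀ ≤ c`.**
[cite: BhargavaHo2022, Thm. 1.1 (shape: averages ordered by height)] -/
theorem averageOnLE_iff_of_pointFamily
    (hΦ : ∀ p : ℕ, p.Prime → ∀ a : Params, (Φ.residueOf p a ∈ Φ.residues p ↔
      ((p : ℤ) ∣ a.a₁ - a₀.a₁ ∧ (p : ℤ) ∣ a.a₂ - a₀.a₂ ∧ (p : ℤ) ∣ a.a₂' - a₀.a₂' ∧
        (p : ℤ) ∣ a.a₃ - a₀.a₃)))
    (ha₀ : a₀.IsMember) (f : Params → ℝ) (c : ℝ) : Φ.AverageOnLE f c ↔ f a₀ ≤ c := by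
  have hev : ∀ᶠ X : ℕ in atTop, Φ.averageOn f X = f a₀ :=
    (eventually_height_lt a₀).mono fun X hX ↦ averageOn_eq_of_pointFamily hΦ ha₀ f hX
  constructor
  · intro h
    refine le_of_forall_pos_lt_add fun ε hε ↦ ?_
    obtain ⟨X, hXle, hXeq⟩ := ((h (ε / 2) (half_pos hε)).and hev).exists
    rw [hXeq] at hXle
    linarith
  · intro hle ε hε
    exact hev.mono fun X hX ↦ by rw [hX]; linarith

/-- **The explicit point family** `⟨fun _ ↦ 1, fun p ↦ {a₀ mod p}⟩` (exponent `1` and the single residue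
class of `a₀` at every prime) IS a point family at `a₀` in the sense of the lemmas above: membership of the
residue of `a` at `p` is `a ≡ a₀ (mod p)` coordinate-wise.
[cite: BhargavaHo2022, §1 (subfamilies defined by congruence conditions)] -/
theorem pointFamily_residues_iff (a₀ : Params) :
    ∀ p : ℕ, p.Prime → ∀ a : Params,
      ((⟨fun _ ↦ 1, fun p ↦ {((a₀.a₁ : ZMod (p ^ 1)), (a₀.a₂ : ZMod (p ^ 1)),
          (a₀.a₂' : ZMod (p ^ 1)), (a₀.a₃ : ZMod (p ^ 1)))}⟩ : CongruenceFamily₂).residueOf p a ∈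
        (⟨fun _ ↦ 1, fun p ↦ {((a₀.a₁ : ZMod (p ^ 1)), (a₀.a₂ : ZMod (p ^ 1)),
          (a₀.a₂' : ZMod (p ^ 1)), (a₀.a₃ : ZMod (p ^ 1)))}⟩ : CongruenceFamily₂).residues p ↔
      ((p : ℤ) ∣ a.a₁ - a₀.a₁ ∧ (p : ℤ) ∣ a.a₂ - a₀.a₂ ∧ (p : ℤ) ∣ a.a₂' - a₀.a₂' ∧
        (p : ℤ) ∣ a.a₃ - a₀.a₃)) := by
  intro p _ a
  have hp : ((p ^ 1 : ℕ) : ℤ) = p := by simp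
  simp only [CongruenceFamily₂.residueOf, Set.mem_singleton_iff, Prod.mk.injEq]
  rw [eq_comm (a := (a.a₁ : ZMod (p ^ 1))), eq_comm (a := (a.a₂ : ZMod (p ^ 1))),
    eq_comm (a := (a.a₂' : ZMod (p ^ 1))), eq_comm (a := (a.a₃ : ZMod (p ^ 1))),
    ZMod.intCast_eq_intCast_iff_dvd_sub, ZMod.intCast_eq_intCast_iff_dvd_sub,
    ZMod.intCast_eq_intCast_iff_dvd_sub, ZMod.intCast_eq_intCast_iff_dvd_sub, hp]

/-! ### §2 The witness member: Wiman's rank-4 curve as the parameter `(0, -29274, 0, 0)` of `F₂` -/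

/-- The member `(a₁, a₂, a₂', a₃) = (0, -29274, 0, 0)` of `F₂` is the congruent number curve
`y² = x³ - 29274²x` (`x - a₂`, `x - a₂'`, `x - a₂''` = `x + 29274`, `x`, `x - 29274`).
[cite: BhargavaHo2022, §1 (definition of F₂)] -/
theorem curve_wiman : (⟨0, -29274, 0, 0⟩ : Params).curve = congruentNumberCurve 29274 := by
  rw [Params.curve_eq]
  ext <;> simp [congruentNumberCurve]

/-- `(0, -29274, 0, 0)` is a member of `F₂` (`Δ = 64·29274⁶ ≠ 0`).
[cite: BhargavaHo2022, §1 (definition of F₂: Δ ≠ 0)] -/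
theorem isMember_wiman : (⟨0, -29274, 0, 0⟩ : Params).IsMember := by
  simp only [Params.IsMember, Params.curveInt]
  norm_num [WeierstrassCurve.Δ, WeierstrassCurve.b₂, WeierstrassCurve.b₄, WeierstrassCurve.b₆,
    WeierstrassCurve.b₈]

/-- **`rank E(ℚ) ≥ 4`** for the member `(0, -29274, 0, 0)`: Wiman's curve, by the tree's kernel
`2`-descent (`CongruentNumber29274.four_le_mordellWeilRank`). [cite: SilvermanAEC2009, Prop. X.1.4] -/
theorem four_le_mordellWeilRank_wiman : 4 ≤ (⟨0, -29274, 0, 0⟩ : Params).curve.mordellWeilRank := by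
  rw [curve_wiman]
  exact CongruentNumber29274.four_le_mordellWeilRank

/-- **`#Sel₃(E) ≥ 81`** for the member `(0, -29274, 0, 0)` (`3⁴ ≤ 3^{rank} ≤ #Sel₃`, Kummer injection).
[cite: SilvermanAEC2009, Thm X.4.2] -/
theorem eightyone_le_natCard_selmerGroup_wiman :
    (81 : ℝ) ≤ (Nat.card ((⟨0, -29274, 0, 0⟩ : Params).curve.selmerGroup 3) : ℝ) := by
  haveI := Params.isElliptic_curve isMember_wiman
  -- Kummer injection `3^{rank} ≤ #Sel₃` (tree `pow_rank_le_card_selmerGroup`, as in p582870's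
  -- `three_pow_mordellWeilRank_le_natCard_selmerGroup`, re-derived here to keep this file route-free)
  have h₀ := (⟨0, -29274, 0, 0⟩ : Params).curve.pow_rank_le_card_selmerGroup (n := 3) (by norm_num)
  have h : (3 : ℝ) ^ (⟨0, -29274, 0, 0⟩ : Params).curve.mordellWeilRank ≤
      (Nat.card ((⟨0, -29274, 0, 0⟩ : Params).curve.selmerGroup 3) : ℝ) := by exact_mod_cast h₀
  have h4 : (3 : ℝ) ^ 4 ≤ (3 : ℝ) ^ (⟨0, -29274, 0, 0⟩ : Params).curve.mordellWeilRank :=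
    pow_le_pow_right₀ (by norm_num) four_le_mordellWeilRank_wiman
  linarith [show (3 : ℝ) ^ 4 = 81 by norm_num]

/-! ### §3 The negative lemmas: `IsLarge` cannot be dropped from I1 -/

/-- **I1 without `IsLarge` is false**: `¬ ∀ Φ : CongruenceFamily₂, Φ.AverageOnLE (fun a ↦ #Sel₃(E_a)) 36`.
Witness: the point family at `(0, -29274, 0, 0)`, whose average is `#Sel₃ ≥ 81` of Wiman's curve. The crux
`SelmerThreeAverageLargeF2` itself is untouched (the witness is not large, `not_isLarge_of_pointFamily`).
[cite: BhargavaHo2022, §1 (large subfamilies); SilvermanAEC2009, Thm X.4.2] -/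
theorem not_selmerThreeAverage_without_isLarge :
    ¬ ∀ Φ : CongruenceFamily₂, Φ.AverageOnLE (fun a ↦ (Nat.card (a.curve.selmerGroup 3) : ℝ)) 36 := by
  intro h
  have h36 := (averageOnLE_iff_of_pointFamily (pointFamily_residues_iff ⟨0, -29274, 0, 0⟩)
    isMember_wiman _ 36).mp (h _)
  linarith [eightyone_le_natCard_selmerGroup_wiman]

/-- **Nor does «nonempty residue set at every prime» rescue it**:
`¬ ∀ Φ, (∀ p prime, (Φ.residues p).Nonempty) → Φ.AverageOnLE (fun a ↦ #Sel₃(E_a)) 36` (the point family has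
one residue at every prime). [cite: BhargavaHo2022, §1 (large subfamilies)] -/
theorem not_selmerThreeAverage_of_residues_nonempty_without_isLarge :
    ¬ ∀ Φ : CongruenceFamily₂, (∀ p : ℕ, p.Prime → (Φ.residues p).Nonempty) →
      Φ.AverageOnLE (fun a ↦ (Nat.card (a.curve.selmerGroup 3) : ℝ)) 36 := by
  intro h
  have h36 := (averageOnLE_iff_of_pointFamily (pointFamily_residues_iff ⟨0, -29274, 0, 0⟩)
    isMember_wiman _ 36).mp (h _ (residues_nonempty_of_pointFamily _ _
      (pointFamily_residues_iff ⟨0, -29274, 0, 0⟩)))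
  linarith [eightyone_le_natCard_selmerGroup_wiman]

/-- The unrestricted sentence fails for EVERY constant `c < 81`, not only for `36`.
[cite: SilvermanAEC2009, Thm X.4.2] -/
theorem not_selmerThreeAverage_without_isLarge_of_lt {c : ℝ} (hc : c < 81) :
    ¬ ∀ Φ : CongruenceFamily₂, Φ.AverageOnLE (fun a ↦ (Nat.card (a.curve.selmerGroup 3) : ℝ)) c := by
  intro h
  have hc' := (averageOnLE_iff_of_pointFamily (pointFamily_residues_iff ⟨0, -29274, 0, 0⟩)
    isMember_wiman _ c).mp (h _)
  linarith [eightyone_le_natCard_selmerGroup_wiman]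

/-- The same for the item's instrument, the exponential rank moment (cf. p582870
`rankMomentThree_of_selmerThreeAverageLargeF2`, which derives `Φ.AverageOnLE (fun a ↦ 3^{rank E_a}) 36` on
every LARGE `Φ` from I1): `¬ ∀ Φ, Φ.AverageOnLE (fun a ↦ 3^{rank E_a}) 36`.
[cite: SilvermanAEC2009, Prop. X.1.4] -/
theorem not_rankMomentThree_without_isLarge :
    ¬ ∀ Φ : CongruenceFamily₂, Φ.AverageOnLE (fun a ↦ (3 : ℝ) ^ a.curve.mordellWeilRank) 36 := by
  intro h
  have h36 := (averageOnLE_iff_of_pointFamily (pointFamily_residues_iff ⟨0, -29274, 0, 0⟩)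
    isMember_wiman _ 36).mp (h _)
  have h4 : (3 : ℝ) ^ 4 ≤ (3 : ℝ) ^ (⟨0, -29274, 0, 0⟩ : Params).curve.mordellWeilRank :=
    pow_le_pow_right₀ (by norm_num) four_le_mordellWeilRank_wiman
  linarith [show (3 : ℝ) ^ 4 = 81 by norm_num]

/-- **The witness sits exactly outside I1's hypothesis**: the point family at `(0, -29274, 0, 0)` is not
large, so `SelmerThreeAverageLargeF2` (BY NAME) says nothing about it — the crux is neither proved nor
refuted here. [cite: BhargavaHo2022, §1 (definition of "large")] -/
theorem not_isLarge_pointFamily_wiman :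
    ¬ (⟨fun _ ↦ 1, fun p ↦ {(((0 : ℤ) : ZMod (p ^ 1)), ((-29274 : ℤ) : ZMod (p ^ 1)),
        ((0 : ℤ) : ZMod (p ^ 1)), ((0 : ℤ) : ZMod (p ^ 1)))}⟩ : CongruenceFamily₂).IsLarge :=
  not_isLarge_of_pointFamily _ _ (pointFamily_residues_iff ⟨0, -29274, 0, 0⟩)

end Summit.BirchSwinnertonDyer.BirchSwinnertonDyer.Theorems

end
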